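import Literature.NumberTheory.Automorphic.FundamentalDomainUnfolding
import HarnessLib

/-!
# Coset unfolding for a finite-index subgroup of an ARBITRARY discrete `Γ ≤ GL₂(ℝ)`

Topic `NumberTheory/Automorphic`; namespace `Literature.NumberTheory.Automorphic`. Theorems only, on top of `FundamentalDomainUnfolding` (`IsHypFundamentalDomain Γ F`, the
unfolding `Σ_{γ ∈ Γ} ∫_F φ(γ w) dμ(w) = 2∫_ℍ φ`, `ae_tsum_indicator_inv_smul`). This is the companion
of `FundamentalDomainCosetUnfolding` (which treats `Γ' ≤ SL₂(ℤ)` against the modular surface `𝒟`)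
for an arbitrary pair `Γ' ≤ Γ ≤ GL₂(ℝ)` inside the image of `SL₂(ℝ)`, `-1 ∈ Γ'`, `Γ` countable,
`[Γ : Γ'] < ∞` — the generality needed for level structures on quaternionic ∕ Cartan unit groups,
which are not subgroups of `SL₂(ℤ)` (Iwaniec, *Spectral Methods*, Prop. 2.4: a fundamental domain of
`Γ'` is, up to null sets, a union of `[Γ : Γ']` translates of one of `Γ`):

* `setLIntegral_eq_setLIntegral_sum_cosets'` — for ANY fundamental domains `F` of `Γ` and `F₁` of
  `Γ'` and a measurable `Γ'`-invariant `ψ ≥ 0`: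
  **`∫⁻_{F₁} ψ dμ = ∫⁻_F Σ_{q ∈ Γ/Γ'} ψ((out q)⁻¹ w) dμ(w)`**;
* `setLIntegral_eq_relIndex_mul_setLIntegral` — for a `Γ`-invariant `ψ`:
  **`∫⁻_{F₁} ψ dμ = [Γ : Γ'] · ∫⁻_F ψ dμ`**;
* `volume_eq_relIndex_mul_volume` — **`vol(F₁) = [Γ : Γ'] · vol(F)`**.

Proof (as in `FundamentalDomainCosetUnfolding`): unfold `φ = 𝟙_{F₁} ψ` over `(Γ, F)`
(`tsum_setLIntegral_smul_eq`: `Σ_{g ∈ Γ} ∫_F φ(g⁻¹w) = 2∫_{F₁} ψ`), regroup `Γ = ⊔_q (out q)Γ'`,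
`g = (out q)δ`, `φ(g⁻¹ w) = 𝟙_{F₁}(δ⁻¹ v) ψ(v)`, `v = (out q)⁻¹ w`, and `Σ_{δ ∈ Γ'} 𝟙_{F₁}(δ⁻¹ v) = 2`
for a.e. `v` (`ae_tsum_indicator_inv_smul` for `(Γ', F₁)`, transported along `w ↦ (out q)⁻¹ w`).

## References

* H. Iwaniec, *Spectral Methods of Automorphic Forms*, 2nd ed., GSM 53, AMS 2002, §2.2–2.4
  (Prop. 2.4, the domain of a finite-index subgroup), PDF pp. 28–31. [cite: Iwaniec2002, §2.4 Prop. 2.4]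
* G. Shimura, *Introduction to the Arithmetic Theory of Automorphic Functions*, 1971, §2.1 and
  Prop. 1.32 (measure of `Γ'∖ℍ` = index × measure of `Γ∖ℍ`).

## Mathlib / tree search

Tree: `IsHypFundamentalDomain`, `tsum_setLIntegral_smul_eq`, `ae_tsum_indicator_inv_smul`
(`FundamentalDomainUnfolding`); the `SL₂(ℤ)`-relative versions `setLIntegral_eq_setLIntegral_fd_sum_cosets`,
`volume_eq_index_mul_of_isHypFundamentalDomain_map` (`FundamentalDomainCosetUnfolding`,
`HypFundamentalDomainVolume`) are the case `Γ = SL₂(ℤ)`, `F = 𝒟`. Mathlib: `Subgroup.subgroupOf`,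
`Subgroup.subgroupOfEquivOfLe`, `Subgroup.relIndex`, `Subgroup.index_eq_card`, `ENNReal.tsum_prod'`,
`Equiv.tsum_eq`, `QuotientGroup.eq`, `MeasureTheory.measure_preimage_smul`.
-/

noncomputable section

open MeasureTheory Set Filter UpperHalfPlane Matrix
open scoped ENNReal MatrixGroups Pointwise Topology

namespace Literature.NumberTheory.Automorphic

/-! ### 1. Regrouping a sum over `Γ` by the cosets of a subgroup -/

section Cosets

variable {G : Type*} [Group G] (H : Subgroup G)

/-- Regrouping an unconditional sum over `G` by the left cosets of `H`:
`Σ_{g} a(g) = Σ_q Σ_{δ ∈ H} a((out q) δ)` (in `ℝ≥0∞`), through the bijection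
`(q, δ) ↦ (out q) δ : (G ⧸ H) × H ≃ G`. [folklore] -/
private theorem tsum_eq_tsum_cosets (a : G → ℝ≥0∞) :
    ∑' g : G, a g = ∑' q : G ⧸ H, ∑' δ : H, a (Quotient.out q * δ) := by
  let e : (G ⧸ H) × H ≃ G :=
    { toFun := fun p => Quotient.out p.1 * p.2
      invFun := fun g => ⟨QuotientGroup.mk g,
        ⟨(Quotient.out (QuotientGroup.mk g : G ⧸ H))⁻¹ * g,
          QuotientGroup.eq.mp (QuotientGroup.out_eq' (QuotientGroup.mk g : G ⧸ H))⟩⟩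
      left_inv := fun p => by
        obtain ⟨q, δ⟩ := p
        have hq : (QuotientGroup.mk (Quotient.out q * (δ : G)) : G ⧸ H) = q := by
          rw [QuotientGroup.mk_mul_of_mem _ δ.2, QuotientGroup.out_eq']
        ext1
        · exact hq
        · apply Subtype.ext
          simp only [hq, inv_mul_cancel_left]
      right_inv := fun g => by simp only [mul_inv_cancel_left] }
  rw [← Equiv.tsum_eq e, ENNReal.tsum_prod']
  rfl

end Cosets

/-! ### 2. Coset unfolding for `Γ' ≤ Γ ≤ GL₂(ℝ)` -/

section FiniteIndexUnfolding

variable {Γ Γ' : Subgroup (GL (Fin 2) ℝ)} {F F₁ : Set ℍ}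

/-- **Coset unfolding, general discrete `Γ`.** Let `Γ ≤ GL₂(ℝ)` lie in the image of `SL₂(ℝ)` and be
countable, `F` a fundamental domain of `Γ`, `Γ' ≤ Γ` a subgroup containing `-1` with finitely many
cosets (a `Fintype` structure on `Γ / Γ'`), `F₁` ANY fundamental domain of `Γ'`, and `ψ ≥ 0` measurable
and `Γ'`-invariant. Then `∫⁻_{F₁} ψ dμ = ∫⁻_F Σ_{q ∈ Γ/Γ'} ψ((out q)⁻¹ w) dμ(w)`.
[cite: Iwaniec2002, §2.4 Prop. 2.4] -/
theorem setLIntegral_eq_setLIntegral_sum_cosets'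
    (hΓ : Γ ≤ (Matrix.SpecialLinearGroup.toGL : SL(2, ℝ) →* GL (Fin 2) ℝ).range)
    (hc : (Γ : Set (GL (Fin 2) ℝ)).Countable) (hF : IsHypFundamentalDomain Γ F)
    (hle : Γ' ≤ Γ) (hneg : (-1 : GL (Fin 2) ℝ) ∈ Γ') [Fintype (Γ ⧸ Γ'.subgroupOf Γ)]
    (hF₁ : IsHypFundamentalDomain Γ' F₁)
    {ψ : ℍ → ℝ≥0∞} (hψm : Measurable ψ) (hψ : ∀ γ ∈ Γ', ∀ w : ℍ, ψ (γ • w) = ψ w) :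
    ∫⁻ w in F₁, ψ w =
      ∫⁻ w in F, ∑ q : Γ ⧸ Γ'.subgroupOf Γ, ψ (((Quotient.out q : Γ) : GL (Fin 2) ℝ)⁻¹ • w) := by
  classical
  haveI : Countable Γ := hc.to_subtype
  haveI : Countable (Γ'.subgroupOf Γ) := Subtype.countable
  -- the test function `φ = 𝟙_{F₁} ψ`
  set φ : ℍ → ℝ≥0∞ := fun w => F₁.indicator (fun _ => (1 : ℝ≥0∞)) w * ψ w with hφ
  have hφm : Measurable φ := ((measurable_const.indicator hF₁.measurableSet).mul hψm)
  have hφint : ∫⁻ w, φ w = ∫⁻ w in F₁, ψ w := by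
    rw [← lintegral_indicator hF₁.measurableSet]
    refine lintegral_congr fun w => ?_
    by_cases hw : w ∈ F₁
    · simp [hφ, Set.indicator_of_mem hw]
    · simp [hφ, Set.indicator_of_notMem hw]
  -- unfolding over `(Γ, F)`: `Σ_{γ ∈ Γ} ∫_F φ(γ w) = 2 ∫_{F₁} ψ`
  have hunf := tsum_setLIntegral_smul_eq hΓ (hle hneg) hc hF hφm.aemeasurable
  rw [hφint] at hunf
  -- reindex the sum by `γ ↦ γ⁻¹`
  have hre : ∑' γ : Γ, ∫⁻ w in F, φ ((γ : GL (Fin 2) ℝ) • w) =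
      ∑' g : Γ, ∫⁻ w in F, φ ((g : GL (Fin 2) ℝ)⁻¹ • w) := by
    rw [← Equiv.tsum_eq (Equiv.inv Γ)]
    refine tsum_congr fun g => ?_
    simp only [Equiv.inv_apply, Subgroup.coe_inv]
  rw [hre, tsum_eq_tsum_cosets (Γ'.subgroupOf Γ)] at hunf
  -- the inner sum over `δ ∈ Γ'`, for each coset `q`
  have hinner : ∀ q : Γ ⧸ Γ'.subgroupOf Γ,
      ∑' δ : Γ'.subgroupOf Γ, ∫⁻ w in F, φ (((Quotient.out q * (δ : Γ) : Γ) : GL (Fin 2) ℝ)⁻¹ • w) =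
        2 * ∫⁻ w in F, ψ (((Quotient.out q : Γ) : GL (Fin 2) ℝ)⁻¹ • w) := by
    intro q
    set A : GL (Fin 2) ℝ := ((Quotient.out q : Γ) : GL (Fin 2) ℝ) with hA
    -- `φ((Aδ)⁻¹ w) = 𝟙_{F₁}(δ⁻¹ (A⁻¹ w)) ψ(A⁻¹ w)`
    have hterm : ∀ (δ : Γ'.subgroupOf Γ) (w : ℍ),
        φ (((Quotient.out q * (δ : Γ) : Γ) : GL (Fin 2) ℝ)⁻¹ • w) =
          F₁.indicator (fun _ => (1 : ℝ≥0∞)) (((δ : Γ) : GL (Fin 2) ℝ)⁻¹ • A⁻¹ • w) * ψ (A⁻¹ • w) := by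
      intro δ w
      have hδ : (((δ : Γ) : GL (Fin 2) ℝ))⁻¹ ∈ Γ' := Γ'.inv_mem (Subgroup.mem_subgroupOf.mp δ.2)
      simp only [hφ]
      rw [Subgroup.coe_mul, _root_.mul_inv_rev, mul_smul, hψ _ hδ]
    simp_rw [hterm]
    have hmeasA : Measurable fun w : ℍ => A⁻¹ • w := measurable_const_smul _
    have hmeas : ∀ δ : Γ'.subgroupOf Γ, AEMeasurable
        (fun w : ℍ => F₁.indicator (fun _ => (1 : ℝ≥0∞)) (((δ : Γ) : GL (Fin 2) ℝ)⁻¹ • A⁻¹ • w) *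
          ψ (A⁻¹ • w)) (volume.restrict F) := by
      intro δ
      refine (Measurable.mul ?_ (hψm.comp hmeasA)).aemeasurable
      have e : (fun w : ℍ => F₁.indicator (fun _ => (1 : ℝ≥0∞)) (((δ : Γ) : GL (Fin 2) ℝ)⁻¹ • A⁻¹ • w)) =
          (fun v : ℍ => F₁.indicator (fun _ => (1 : ℝ≥0∞)) v) ∘
            fun w : ℍ => ((((δ : Γ) : GL (Fin 2) ℝ)⁻¹ * A⁻¹ : GL (Fin 2) ℝ)) • w := by
        funext w; simp only [Function.comp_apply, mul_smul]
      rw [e]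
      exact (measurable_const.indicator hF₁.measurableSet).comp (measurable_const_smul _)
    rw [← lintegral_tsum hmeas]
    simp_rw [ENNReal.tsum_mul_right]
    -- a.e. `Σ_δ 𝟙_{F₁}(δ⁻¹ A⁻¹ w) = 2`, transported along `w ↦ A⁻¹ w`
    have hae' := ae_tsum_indicator_inv_smul (hle.trans hΓ) hneg (hc.mono hle) hF₁ (1 : ℝ≥0∞)
    have hae : ∀ᵐ v : ℍ,
        (∑' δ : Γ'.subgroupOf Γ, F₁.indicator (fun _ => (1 : ℝ≥0∞)) (((δ : Γ) : GL (Fin 2) ℝ)⁻¹ • v)) = 2 := by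
      filter_upwards [hae'] with v hv
      rw [one_add_one_eq_two] at hv
      rw [← hv, ← Equiv.tsum_eq (Subgroup.subgroupOfEquivOfLe hle).toEquiv]
      rfl
    have haeA : ∀ᵐ w : ℍ,
        (∑' δ : Γ'.subgroupOf Γ, F₁.indicator (fun _ => (1 : ℝ≥0∞)) (((δ : Γ) : GL (Fin 2) ℝ)⁻¹ • A⁻¹ • w)) = 2 := by
      rw [ae_iff] at hae ⊢
      have hsub : {w : ℍ | ¬ (∑' δ : Γ'.subgroupOf Γ,
            F₁.indicator (fun _ => (1 : ℝ≥0∞)) (((δ : Γ) : GL (Fin 2) ℝ)⁻¹ • A⁻¹ • w)) = 2} ⊆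
          (fun w : ℍ => A⁻¹ • w) ⁻¹'
            {v : ℍ | ¬ (∑' δ : Γ'.subgroupOf Γ,
              F₁.indicator (fun _ => (1 : ℝ≥0∞)) (((δ : Γ) : GL (Fin 2) ℝ)⁻¹ • v)) = 2} :=
        fun w hw => hw
      refine measure_mono_null hsub ?_
      rw [MeasureTheory.measure_preimage_smul]
      exact hae
    rw [← lintegral_const_mul' 2 _ (by norm_num)]
    refine lintegral_congr_ae ((ae_restrict_of_ae haeA).mono fun w hw => ?_)
    beta_reduce
    rw [hw]
  simp_rw [hinner] at hunf
  rw [tsum_fintype, ← Finset.mul_sum, ← lintegral_finsetSum' _ (fun q _ => ?_)] at hunf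
  · exact ((ENNReal.mul_right_inj two_ne_zero ENNReal.ofNat_ne_top).mp hunf).symm
  · exact (hψm.comp (measurable_const_smul _)).aemeasurable

/-- **`∫⁻_{F₁} ψ = [Γ : Γ'] · ∫⁻_F ψ`** for a `Γ`-INVARIANT `ψ ≥ 0`: the integral over any fundamental
domain of a finite-index `Γ' ≤ Γ` (`-1 ∈ Γ'`) is the index times the integral over any fundamental
domain of `Γ` (Iwaniec Prop. 2.4; Shimura Prop. 1.32 ∕ §2.1). [cite: Iwaniec2002, §2.4 Prop. 2.4] -/
theorem setLIntegral_eq_relIndex_mul_setLIntegral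
    (hΓ : Γ ≤ (Matrix.SpecialLinearGroup.toGL : SL(2, ℝ) →* GL (Fin 2) ℝ).range)
    (hc : (Γ : Set (GL (Fin 2) ℝ)).Countable) (hF : IsHypFundamentalDomain Γ F)
    (hle : Γ' ≤ Γ) (hneg : (-1 : GL (Fin 2) ℝ) ∈ Γ') [(Γ'.subgroupOf Γ).FiniteIndex]
    (hF₁ : IsHypFundamentalDomain Γ' F₁)
    {ψ : ℍ → ℝ≥0∞} (hψm : Measurable ψ) (hψ : ∀ γ ∈ Γ, ∀ w : ℍ, ψ (γ • w) = ψ w) :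
    ∫⁻ w in F₁, ψ w = (Γ'.relIndex Γ : ℝ≥0∞) * ∫⁻ w in F, ψ w := by
  classical
  letI : Fintype (Γ ⧸ Γ'.subgroupOf Γ) := Subgroup.fintypeQuotientOfFiniteIndex
  rw [setLIntegral_eq_setLIntegral_sum_cosets' hΓ hc hF hle hneg hF₁ hψm
    (fun γ hγ w => hψ γ (hle hγ) w)]
  have hq : ∀ (q : Γ ⧸ Γ'.subgroupOf Γ) (w : ℍ),
      ψ (((Quotient.out q : Γ) : GL (Fin 2) ℝ)⁻¹ • w) = ψ w :=
    fun q w => hψ _ (Γ.inv_mem (Quotient.out q).2) w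
  simp_rw [hq, Finset.sum_const, Finset.card_univ, nsmul_eq_mul]
  rw [lintegral_const_mul' _ _ (ENNReal.natCast_ne_top _), Subgroup.relIndex, Subgroup.index_eq_card,
    Nat.card_eq_fintype_card]

/-- **`vol(F₁) = [Γ : Γ'] · vol(F)`**: the hyperbolic area of any fundamental domain of a finite-index
`Γ' ≤ Γ` (`-1 ∈ Γ'`). [cite: Iwaniec2002, §2.4 Prop. 2.4] -/
theorem volume_eq_relIndex_mul_volume
    (hΓ : Γ ≤ (Matrix.SpecialLinearGroup.toGL : SL(2, ℝ) →* GL (Fin 2) ℝ).range)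
    (hc : (Γ : Set (GL (Fin 2) ℝ)).Countable) (hF : IsHypFundamentalDomain Γ F)
    (hle : Γ' ≤ Γ) (hneg : (-1 : GL (Fin 2) ℝ) ∈ Γ') [(Γ'.subgroupOf Γ).FiniteIndex]
    (hF₁ : IsHypFundamentalDomain Γ' F₁) :
    volume F₁ = (Γ'.relIndex Γ : ℝ≥0∞) * volume F := by
  have h := setLIntegral_eq_relIndex_mul_setLIntegral hΓ hc hF hle hneg hF₁ (ψ := fun _ => (1 : ℝ≥0∞))
    measurable_const (fun _ _ _ => rfl)
  simpa only [setLIntegral_one] using h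

end FiniteIndexUnfolding

end Literature.NumberTheory.Automorphic

end
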